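import Summits.Ventures.QEC.Census.FoldTowerData144
import Summits.Ventures.QEC.Census.FoldTowerData288
import Summits.Ventures.QEC.Census.FoldScanPT2
import HarnessLib

/-!
# Fold certificate of `[[288,12,18]]` — the continuations (what every enumerated word must pass)

Level `L` node = the certified fibre enumeration (`nodeCheckPT`, `FoldDefs3`: table-assisted subset scan) of one small kernel word with continuation
`k_L` on the big words found: a side-match of the low-weight outputs against the stored class lists (this is what makes
the lists `T36_10`, `T72_10` COMPLETE, proved in `FoldTowerSound`), the skip of the zero word and of the special
low-weight classes (own files `FoldTowerZero*`, `FoldTowerLift*`), and the next level's node. Level 3 outputs are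
matched against `T144`; level 4 (`node4`, over `T144`) matches against `T288`. Semantics: `FoldTowerSound`.
-/

set_option maxRecDepth 100000

namespace Summit.Ventures.QEC.Census.Fold.Tower

open Summit.Ventures.QEC.Census Summit.Ventures.QEC.Census.Fold

/-- level-4 outputs (288-words): must be a stored `T288` class (zero word allowed). -/
noncomputable def k4 (S : List ℕ) : Bool := (matchRep 12 12 md288 (repStore md288 T288) (T288.elem 0) S).isSome

/-- sliced level-4 node. -/
noncomputable def node4Mod (t q res : ℕ) : Bool :=
  nodeCheckModPT G4 (tab TF4 144) (tab TP4 144) (tab TR4 144) 16 509 false k4 (bitsOf 144 0 t) q res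

/-- level-3 outputs (144-words): must be a stored `T144` class. -/
noncomputable def k3 (S : List ℕ) : Bool := (matchRep 12 6 md144 (repStore md144 T144) (T144.elem 0) S).isSome

/-- level-3 node on a 72-word: zero word and the H^Z-row class `spec72` have their own files. -/
noncomputable def node3 (S : List ℕ) : Bool :=
  match S with
  | [] => true
  | _ => (S.length == 6 && (matchRep 6 6 mdS (repStore mdS [spec72]) ([spec72].elem 0) S).isSome) ||
      nodeCheckPT G3 (tab TF3 72) (tab TP3 72) (tab TR3 72) 16 127 false k3 S

/-- level-2 outputs (72-words): side-match of weight ≤ 11 against `T72_10`, then the level-3 node. -/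
noncomputable def k2 (S : List ℕ) : Bool :=
  (decide (11 < S.length) || (matchRep 6 6 md72 (repStore md72 T72_10) (T72_10.elem 0) S).isSome) && node3 S

/-- level-2 node on a 36-word: zero word and the two special weight-4 classes have their own files. -/
noncomputable def node2 (S : List ℕ) : Bool :=
  match S with
  | [] => true
  | _ => (S.length == 4 && (matchRep 6 3 mdS (repStore mdS [spec36a, spec36b]) ([spec36a, spec36b].elem 0) S).isSome) ||
      nodeCheckPT G2 (tab TF2 36) (tab TP2 36) (tab TR2 36) 16 61 false k2 S

/-- level-1 outputs (36-words): side-match of weight ≤ 11 against `T36_10`, then the level-2 node. -/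
noncomputable def k1 (S : List ℕ) : Bool :=
  (decide (11 < S.length) || (matchRep 6 3 md36 (repStore md36 T36_10) (T36_10.elem 0) S).isSome) && node2 S

/-- sliced level-1 node on an 18-word (a `T18` representative): residue class `res mod q` of its level-1 outputs. -/
noncomputable def node1Mod (t q res : ℕ) : Bool :=
  nodeCheckModPT G1 (tab TF1 18) (tab TP1 18) (tab TR1 18) 16 31 false k1 (bitsOf 18 0 t) q res

/-- run a work plan: triples `(t, q, res)`. -/
noncomputable def runPlan (f : ℕ → ℕ → ℕ → Bool) (L : List (ℕ × ℕ × ℕ)) : Bool := L.all fun p => f p.1 p.2.1 p.2.2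

end Summit.Ventures.QEC.Census.Fold.Tower
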